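import Summits.BirchSwinnertonDyer.BirchSwinnertonDyer.Theorems.AlignedTransportAtTwoMainConjectureOfRankZeroBSDAtTwoPointFieldCarrierGalois
import Literature.NumberTheory.IwasawaTheory.SymmetricThreeTowerExactCentral
import Literature.NumberTheory.IwasawaTheory.ClassicalMuVanishesTwoPowerGaloisRat
import HarnessLib

/-!
# Route `AlignedTransportAtTwo`, crux C2 `MainConjectureOfRankZeroBSDAtTwo` (stmt-BirchSwinnertonDyer-22298):
# THE EXACT RELATION `e_n(ℚ(W[2], √−1)) = e_n(ℚ(√−1, √Δ_W)) + 2·e_n(ℚ(β_j, √−1))` AT EVERY LAYER (both signs of `Δ_W`)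

HONEST FRAMING. WIDTH-5 attached prover seat `bsd-line-att-p3` g35 on line `birth` of the lead `bsd-line-att-p2`; `--supports`
stmt-BirchSwinnertonDyer-22298, closes nothing; BSD is NOT proved; crux C2, its verdict «blocked-on `Rank1Residual.GreenbergMuConjectureIrreducible`»
and every registered stub untouched (PFμ⁺ = `PointFieldMuCycAtTwo` stays OPEN: this file re-prices it exactly, it does not prove it). THEOREMS ONLY.

WHAT. `W(ℚ)[2] = 0`, `Δ_W, −Δ_W ∉ ℚ²`, `i² = −1`, `M = ℚ(W[2]) ⊔ ℚ⟮i⟯`; `σ, τ` the `S₃`-pair of the prequel (`⟨σ⟩ = Fix ℚ(i,δ)`, `⟨τ⟩ = Fix ℚ(β_j,i)`,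
`⟨σ,τ⟩ = Gal(M/ℚ(i))`).  att-p4 g30's EXACT `S₃` relation `classNumberPExp_symmetricThree_exact` (Walter / Caputo–Nuccio Prop. 3.12 per layer; the pair
need not generate `Gal(L/F)`) with `F = ℚ`, `L = M`, fixed fields carried to the models in `ℚ̄` by `restrict_algEquiv`:
  ★★ `classNumberPExp_sup_adjoin_I_exact`: **`e_n(κ|_M) + 2·e_n(κ|_{ℚ(i)}) = e_n(κ|_{ℚ(i,δ)}) + 2·e_n(κ|_{ℚ(β_j,i)})`** for every `n` (`κ` a `ℤ₂`-extension of
  `ℚ` with `κ ∘ res` onto for the four fields — for the cyclotomic `κ`: `Δ_W, ±2Δ_W ∉ ℚ²`, att-p4 g29), and with `e_n(ℚ(i)) = 0` (Weber; this seat's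
  `classNumberPExp_adjoin_sqrt_neg_one_eq_zero`):
  ★★ `classNumberPExp_sup_adjoin_I_eq`: **`e_n(ℚ(W[2], i)) = e_n(ℚ(i, √Δ_W)) + 2·e_n(ℚ(β_j, i))`** — att-p3 g34's «PFμ⁺ carrier ⟺ CM point field»
  (`…PointFieldCarrierCMIff`) made an EXACT identity at every layer; the only other term is the biquadratic `ℚ(i, √Δ_W)` (`μ₂ = 0`, fact-free:
  `classicalMuVanishes_of_biquadratic` / `classicalMuVanishes_of_isGalois_rat_of_finrank_eq_two_pow`).  Informally `μ₂(M) = 2·μ₂(ℚ(β_j,i))`,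
  `λ₂(M) = λ₂(ℚ(i,√Δ_W)) + 2·λ₂(ℚ(β_j,i))`; the reflection-pair identity `e_n(ℚ(β_j,√−Δ_W)) = e_n(ℚ(β_j,i)) + e_n(ℚ(√−Δ_W))`
  (`IwasawaTheory.SymmetricThreeTowerExactCentral`) needs in addition the central involution `Gal(M/ℚ(W[2]))` — successor work.

References: [CaputoNuccio2020] Prop. 3.12, Rem. 3.13; [Iwasawa1973MuInvariants] §4; [Washington1997] §13.1, Prop. 13.22; tree: att-p4 g30
`IwasawaTheory.SymmetricThreeTowerExact`, this seat's `…PointFieldCarrierGalois`, `IwasawaTheory.ClassNumberPExpZeroAdjoinSqrtNegOne`.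
-/

set_option linter.dupNamespace false
set_option autoImplicit false

noncomputable section

open scoped Classical NumberField IntermediateField

namespace Summit.BirchSwinnertonDyer.BirchSwinnertonDyer.Theorems.AlignedTransportAtTwoPointFieldCarrierDSixExact

open NumberField Polynomial WeierstrassCurve IntermediateField Field
  Literature.NumberTheory.EllipticCurves Literature.NumberTheory.EllipticCurves.Greenberg1999
  Literature.NumberTheory.EllipticCurves.DokchitserDokchitser2012
  Literature.NumberTheory.EllipticCurves.ZpExtension Literature.NumberTheory.GaloisRepresentations
  Literature.NumberTheory.IwasawaTheory Literature.NumberTheory.NumberFields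
  Summit.BirchSwinnertonDyer.BirchSwinnertonDyer.Theorems.AlignedTransportAtTwoFineRoad.DivisionCubic
  Summit.BirchSwinnertonDyer.BirchSwinnertonDyer.Theorems.AlignedTransportAtTwoFineRoad.TowerImageDelta
  Summit.BirchSwinnertonDyer.BirchSwinnertonDyer.Theorems.AlignedTransportAtTwoCubicClosureParity
  Summit.BirchSwinnertonDyer.BirchSwinnertonDyer.Theorems.AlignedTransportAtTwoSexticTowerGrowth
  Summit.BirchSwinnertonDyer.BirchSwinnertonDyer.Theorems.AlignedTransportAtTwoSexticNormRelationDescent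
  Summit.BirchSwinnertonDyer.BirchSwinnertonDyer.Theorems.AlignedTransportAtTwoSexticNormRelationDescentSignFree
  Summit.BirchSwinnertonDyer.BirchSwinnertonDyer.Theorems.AlignedTransportAtTwoSexticNormRelationDescentSignFreeAdjoinI
  Summit.BirchSwinnertonDyer.BirchSwinnertonDyer.Theorems.AlignedTransportAtTwoSexticLambdaKuroda
  Summit.BirchSwinnertonDyer.BirchSwinnertonDyer.Theorems.AlignedTransportAtTwoPointFieldCarrierCM
  Summit.BirchSwinnertonDyer.BirchSwinnertonDyer.Theorems.AlignedTransportAtTwoPointFieldCarrierCMIff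
  Summit.BirchSwinnertonDyer.BirchSwinnertonDyer.Theorems.AlignedTransportAtTwoResolventMuUnconditional
  Summit.BirchSwinnertonDyer.BirchSwinnertonDyer.Theorems.AlignedTransportAtTwoPointFieldCarrierGalois

variable (W : WeierstrassCurve ℚ) [W.IsElliptic]

/-! ## §4 The exact `S₃` relation of the carrier along the cyclotomic `ℤ₂`-tower -/

set_option maxHeartbeats 800000 in
set_option synthInstance.maxHeartbeats 80000 in
/-- ★★ **THE EXACT RELATION `e_n(M) + 2·e_n(ℚ(i)) = e_n(ℚ(i, √Δ_W)) + 2·e_n(ℚ(β_j, i))` at every layer** (restricted form).  `W(ℚ)[2] = 0`,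
`Δ_W, −Δ_W ∉ ℚ²`, `i² = −1`, `M = ℚ(W[2]) ⊔ ℚ⟮i⟯`, `κ` a `ℤ₂`-extension of `ℚ` with `κ ∘ res` onto for `M`, `ℚ⟮i⟯`, `R = ℚ⟮i⟯ ⊔ ℚ⟮δ⟯`,
`P_j = ℚ⟮β_j⟯ ⊔ ℚ⟮i⟯` (for the cyclotomic `κ` these hold when `2Δ_W, −2Δ_W ∉ ℚ²`, att-p4 g29): for every `n`,
**`e_n(κ|_M) + 2·e_n(κ|_{ℚ(i)}) = e_n(κ|_R) + 2·e_n(κ|_{P_j})`** — att-p4 g30's `classNumberPExp_symmetricThree_exact` (Walter / Caputo–Nuccio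
Prop. 3.12 per layer) on the `S₃`-pair of §3, whose fixed fields `M^{σ} = R_M`, `M^{τ} = (P_j)_M`, `M^{⟨σ,τ⟩} = ℚ(i)_M` are carried to the models in
`ℚ̄` (`restrict_algEquiv`).  No hypothesis on class numbers. [cite: CaputoNuccio2020, Prop. 3.12 and Rem. 3.13] [cite: Washington1997, §13.1] -/
theorem classNumberPExp_sup_adjoin_I_exact (ht : ∀ x : ℚ, ¬ HasRationalTwoTorsionX W x) (hsq : ¬ IsSquare W.Δ)
    (hnegΔ : ¬ IsSquare (-W.Δ)) {i : AlgebraicClosure ℚ} (hi : i ^ 2 = -1) (j : Fin 3) (κ : ZpExtension ℚ 2)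
    [NumberField ↥(W.divisionField 2 ⊔ IntermediateField.adjoin ℚ ({i} : Set (AlgebraicClosure ℚ)))]
    [NumberField ↥(IntermediateField.adjoin ℚ ({i} : Set (AlgebraicClosure ℚ)))]
    [NumberField ↥(IntermediateField.adjoin ℚ ({i} : Set (AlgebraicClosure ℚ)) ⊔ ℚ⟮4 * delta W two_ne_zero⟯)]
    [NumberField ↥(ℚ⟮xT W two_ne_zero j⟯ ⊔ IntermediateField.adjoin ℚ ({i} : Set (AlgebraicClosure ℚ)))]
    (hM : Function.Surjective (κ.toContinuousMonoidHom.comp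
      (absGaloisRestrict ℚ ↥(W.divisionField 2 ⊔ IntermediateField.adjoin ℚ ({i} : Set (AlgebraicClosure ℚ))))))
    (hQ : Function.Surjective (κ.toContinuousMonoidHom.comp
      (absGaloisRestrict ℚ ↥(IntermediateField.adjoin ℚ ({i} : Set (AlgebraicClosure ℚ))))))
    (hR : Function.Surjective (κ.toContinuousMonoidHom.comp
      (absGaloisRestrict ℚ ↥(IntermediateField.adjoin ℚ ({i} : Set (AlgebraicClosure ℚ)) ⊔ ℚ⟮4 * delta W two_ne_zero⟯))))
    (hP : Function.Surjective (κ.toContinuousMonoidHom.comp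
      (absGaloisRestrict ℚ ↥(ℚ⟮xT W two_ne_zero j⟯ ⊔ IntermediateField.adjoin ℚ ({i} : Set (AlgebraicClosure ℚ))))))
    (n : ℕ) :
    classNumberPExp (κ.restrict ↥(W.divisionField 2 ⊔ IntermediateField.adjoin ℚ ({i} : Set (AlgebraicClosure ℚ))) hM) n +
        2 * classNumberPExp (κ.restrict ↥(IntermediateField.adjoin ℚ ({i} : Set (AlgebraicClosure ℚ))) hQ) n =
      classNumberPExp (κ.restrict ↥(IntermediateField.adjoin ℚ ({i} : Set (AlgebraicClosure ℚ)) ⊔ ℚ⟮4 * delta W two_ne_zero⟯) hR) n +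
        2 * classNumberPExp (κ.restrict ↥(ℚ⟮xT W two_ne_zero j⟯ ⊔ IntermediateField.adjoin ℚ ({i} : Set (AlgebraicClosure ℚ))) hP) n := by
  haveI hfd : FiniteDimensional ℚ ↥(W.divisionField 2 ⊔ IntermediateField.adjoin ℚ ({i} : Set (AlgebraicClosure ℚ))) := finiteDimensional_divisionField_two_sup_adjoin_I W hi
  haveI hgal : IsGalois ℚ ↥(W.divisionField 2 ⊔ IntermediateField.adjoin ℚ ({i} : Set (AlgebraicClosure ℚ))) := isGalois_divisionField_two_sup_adjoin_I W hi
  haveI : ∀ E : IntermediateField ℚ ↥(W.divisionField 2 ⊔ IntermediateField.adjoin ℚ ({i} : Set (AlgebraicClosure ℚ))), NumberField ↥E :=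
    fun E ↦ NumberField.mk
  obtain ⟨σ, τ, hσN, hτH, hσ3, hτ2, hrel, hgen⟩ := exists_symmetricThree_pair_sup_adjoin_I W ht hsq hnegΔ hi j
  have hRf := surjective_comp_absGaloisRestrict_of_tower κ ↥(fixedField (Subgroup.zpowers σ)) ↥(W.divisionField 2 ⊔ IntermediateField.adjoin ℚ ({i} : Set (AlgebraicClosure ℚ))) hM
  have hKf := surjective_comp_absGaloisRestrict_of_tower κ ↥(fixedField (Subgroup.zpowers τ)) ↥(W.divisionField 2 ⊔ IntermediateField.adjoin ℚ ({i} : Set (AlgebraicClosure ℚ))) hM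
  have hkf := surjective_comp_absGaloisRestrict_of_tower κ ↥(fixedField (Subgroup.closure {σ, τ})) ↥(W.divisionField 2 ⊔ IntermediateField.adjoin ℚ ({i} : Set (AlgebraicClosure ℚ))) hM
  have main := classNumberPExp_symmetricThree_exact κ ↥(W.divisionField 2 ⊔ IntermediateField.adjoin ℚ ({i} : Set (AlgebraicClosure ℚ))) hM hσ3 hτ2 hrel hRf hKf hkf n
  -- the fixed fields are the restricted models
  have eR : fixedField (Subgroup.zpowers σ) = IntermediateField.restrict (adjoin_I_sup_adjoin_delta_le_sup W i) := by
    rw [hσN]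
    exact @IsGalois.fixedField_fixingSubgroup ℚ _ ↥(W.divisionField 2 ⊔ IntermediateField.adjoin ℚ ({i} : Set (AlgebraicClosure ℚ))) _ _ _ hfd hgal
  have eK : fixedField (Subgroup.zpowers τ) = IntermediateField.restrict (adjoin_xT_sup_adjoin_I_le_sup W i j) := by
    rw [hτH]
    exact @IsGalois.fixedField_fixingSubgroup ℚ _ ↥(W.divisionField 2 ⊔ IntermediateField.adjoin ℚ ({i} : Set (AlgebraicClosure ℚ))) _ _ _ hfd hgal
  have ek : fixedField (Subgroup.closure {σ, τ}) = IntermediateField.restrict (adjoin_I_le_sup W i) := by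
    rw [hgen]
    exact @IsGalois.fixedField_fixingSubgroup ℚ _ ↥(W.divisionField 2 ⊔ IntermediateField.adjoin ℚ ({i} : Set (AlgebraicClosure ℚ))) _ _ _ hfd hgal
  -- transport the three fixed-field terms to the models (the `exact` steps cross the two `ℚ`-algebra structures on subfields of `ℚ̄`)
  have cR := classNumberPExp_restrict_eq_of_algEquiv κ
    ((IntermediateField.equivOfEq eR).trans (IntermediateField.restrict_algEquiv (adjoin_I_sup_adjoin_delta_le_sup W i)).symm) hRf hR n
  have cK := classNumberPExp_restrict_eq_of_algEquiv κ
    ((IntermediateField.equivOfEq eK).trans (IntermediateField.restrict_algEquiv (adjoin_xT_sup_adjoin_I_le_sup W i j)).symm) hKf hP n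
  have ck := classNumberPExp_restrict_eq_of_algEquiv κ
    ((IntermediateField.equivOfEq ek).trans (IntermediateField.restrict_algEquiv (adjoin_I_le_sup W i)).symm) hkf hQ n
  rw [ck, cR, cK] at main
  exact main

/-- ★★ **`e_n(ℚ(W[2], i)) = e_n(ℚ(i, √Δ_W)) + 2·e_n(ℚ(β_j, i))` at every layer** (restricted form; `e_n(ℚ(i)) = 0` folded in).  Same hypotheses as
`classNumberPExp_sup_adjoin_I_exact`.  Reads: the `2`-class numbers along the cyclotomic `ℤ₂`-tower of the PFμ⁺ carrier are those of the biquadratic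
field `ℚ(i, √Δ_W)` times the SQUARE of those of the CM point field `ℚ(β_j, i)` — at every layer, exactly. [cite: CaputoNuccio2020, Prop. 3.12]
[cite: Washington1997, §13.1, Prop. 13.22] -/
theorem classNumberPExp_sup_adjoin_I_eq (ht : ∀ x : ℚ, ¬ HasRationalTwoTorsionX W x) (hsq : ¬ IsSquare W.Δ)
    (hnegΔ : ¬ IsSquare (-W.Δ)) {i : AlgebraicClosure ℚ} (hi : i ^ 2 = -1) (j : Fin 3) (κ : ZpExtension ℚ 2)
    [NumberField ↥(W.divisionField 2 ⊔ IntermediateField.adjoin ℚ ({i} : Set (AlgebraicClosure ℚ)))]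
    [NumberField ↥(IntermediateField.adjoin ℚ ({i} : Set (AlgebraicClosure ℚ)))]
    [NumberField ↥(IntermediateField.adjoin ℚ ({i} : Set (AlgebraicClosure ℚ)) ⊔ ℚ⟮4 * delta W two_ne_zero⟯)]
    [NumberField ↥(ℚ⟮xT W two_ne_zero j⟯ ⊔ IntermediateField.adjoin ℚ ({i} : Set (AlgebraicClosure ℚ)))]
    (hM : Function.Surjective (κ.toContinuousMonoidHom.comp
      (absGaloisRestrict ℚ ↥(W.divisionField 2 ⊔ IntermediateField.adjoin ℚ ({i} : Set (AlgebraicClosure ℚ))))))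
    (hQ : Function.Surjective (κ.toContinuousMonoidHom.comp
      (absGaloisRestrict ℚ ↥(IntermediateField.adjoin ℚ ({i} : Set (AlgebraicClosure ℚ))))))
    (hR : Function.Surjective (κ.toContinuousMonoidHom.comp
      (absGaloisRestrict ℚ ↥(IntermediateField.adjoin ℚ ({i} : Set (AlgebraicClosure ℚ)) ⊔ ℚ⟮4 * delta W two_ne_zero⟯))))
    (hP : Function.Surjective (κ.toContinuousMonoidHom.comp
      (absGaloisRestrict ℚ ↥(ℚ⟮xT W two_ne_zero j⟯ ⊔ IntermediateField.adjoin ℚ ({i} : Set (AlgebraicClosure ℚ))))))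
    (n : ℕ) :
    classNumberPExp (κ.restrict ↥(W.divisionField 2 ⊔ IntermediateField.adjoin ℚ ({i} : Set (AlgebraicClosure ℚ))) hM) n =
      classNumberPExp (κ.restrict ↥(IntermediateField.adjoin ℚ ({i} : Set (AlgebraicClosure ℚ)) ⊔ ℚ⟮4 * delta W two_ne_zero⟯) hR) n +
        2 * classNumberPExp (κ.restrict ↥(ℚ⟮xT W two_ne_zero j⟯ ⊔ IntermediateField.adjoin ℚ ({i} : Set (AlgebraicClosure ℚ))) hP) n := by
  have h := classNumberPExp_sup_adjoin_I_exact W ht hsq hnegΔ hi j κ hM hQ hR hP n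
  have h0 := classNumberPExp_adjoin_sqrt_neg_one_eq_zero hi (κ.restrict ↥(IntermediateField.adjoin ℚ ({i} : Set (AlgebraicClosure ℚ))) hQ) n
  omega


/-! ## §5 Iwasawa invariants: `μ₂ = 0` on the CM point field ⟹ on `M`, with the EXACT `λ` -/

/-- **`μ₂ = 0` on the biquadratic `ℚ(i, √Δ_W)` along any restricted cyclotomic tower** (`Δ_W, −Δ_W, ±2Δ_W ∉ ℚ²`): att-p3 g34's
`classicalMuVanishes_of_biquadratic` (genus theory, fact-free) on the model `ℚ⟮i⟯ ⊔ ℚ⟮δ⟯ ⊆ M` (`√2 ∉ M`, att-p4 g29).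
[cite: Iwasawa1973MuInvariants, §4] [cite: Washington1997, §13.3 Prop. 13.23] -/
theorem classicalMuVanishes_adjoin_I_sup_adjoin_delta (ht : ∀ x : ℚ, ¬ HasRationalTwoTorsionX W x) (hsq : ¬ IsSquare W.Δ)
    (hnegΔ : ¬ IsSquare (-W.Δ)) (h2Δ : ¬ IsSquare (2 * W.Δ)) (hm2Δ : ¬ IsSquare (-2 * W.Δ)) {i : AlgebraicClosure ℚ} (hi : i ^ 2 = -1)
    [NumberField ↥(IntermediateField.adjoin ℚ ({i} : Set (AlgebraicClosure ℚ)) ⊔ ℚ⟮4 * delta W two_ne_zero⟯)] (κR : ZpExtension ↥(IntermediateField.adjoin ℚ ({i} : Set (AlgebraicClosure ℚ)) ⊔ ℚ⟮4 * delta W two_ne_zero⟯) 2) (hκR : κR.IsCyclotomic) : ClassicalMuVanishes κR := by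
  have hiR : i ∈ (IntermediateField.adjoin ℚ ({i} : Set (AlgebraicClosure ℚ)) ⊔ ℚ⟮4 * delta W two_ne_zero⟯) :=
    (le_sup_left : (IntermediateField.adjoin ℚ ({i} : Set (AlgebraicClosure ℚ))) ≤ (IntermediateField.adjoin ℚ ({i} : Set (AlgebraicClosure ℚ)) ⊔ ℚ⟮4 * delta W two_ne_zero⟯)) (IntermediateField.mem_adjoin_simple_self ℚ i)
  have hδR : 4 * delta W two_ne_zero ∈ (IntermediateField.adjoin ℚ ({i} : Set (AlgebraicClosure ℚ)) ⊔ ℚ⟮4 * delta W two_ne_zero⟯) :=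
    (le_sup_right : ℚ⟮4 * delta W two_ne_zero⟯ ≤ (IntermediateField.adjoin ℚ ({i} : Set (AlgebraicClosure ℚ)) ⊔ ℚ⟮4 * delta W two_ne_zero⟯)) (IntermediateField.mem_adjoin_simple_self ℚ _)
  have hx : (⟨i, hiR⟩ : ↥(IntermediateField.adjoin ℚ ({i} : Set (AlgebraicClosure ℚ)) ⊔ ℚ⟮4 * delta W two_ne_zero⟯)) ^ 2 = ((-1 : ℚ) : ↥(IntermediateField.adjoin ℚ ({i} : Set (AlgebraicClosure ℚ)) ⊔ ℚ⟮4 * delta W two_ne_zero⟯)) := by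
    apply (algebraMap ↥(IntermediateField.adjoin ℚ ({i} : Set (AlgebraicClosure ℚ)) ⊔ ℚ⟮4 * delta W two_ne_zero⟯) (AlgebraicClosure ℚ)).injective
    rw [map_pow, map_ratCast]
    push_cast
    exact hi
  have hy : (⟨4 * delta W two_ne_zero, hδR⟩ : ↥(IntermediateField.adjoin ℚ ({i} : Set (AlgebraicClosure ℚ)) ⊔ ℚ⟮4 * delta W two_ne_zero⟯)) ^ 2 = ((W.Δ : ℚ) : ↥(IntermediateField.adjoin ℚ ({i} : Set (AlgebraicClosure ℚ)) ⊔ ℚ⟮4 * delta W two_ne_zero⟯)) := by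
    apply (algebraMap ↥(IntermediateField.adjoin ℚ ({i} : Set (AlgebraicClosure ℚ)) ⊔ ℚ⟮4 * delta W two_ne_zero⟯) (AlgebraicClosure ℚ)).injective
    rw [map_pow, map_ratCast]
    exact (delta_mem_and_sq W).2
  have ha : ¬ IsSquare (-1 : ℚ) := fun ⟨r, hr⟩ ↦ by nlinarith [mul_self_nonneg r]
  have hab : ¬ IsSquare (-1 * W.Δ) := by rwa [neg_one_mul]
  have h2R : ∀ z : ↥(IntermediateField.adjoin ℚ ({i} : Set (AlgebraicClosure ℚ)) ⊔ ℚ⟮4 * delta W two_ne_zero⟯), z ^ 2 ≠ 2 := by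
    intro z hz
    apply forall_sq_ne_two_sup_adjoin_I W ht hsq h2Δ hm2Δ hi ⟨z.1, adjoin_I_sup_adjoin_delta_le_sup W i z.2⟩
    have h := congrArg (algebraMap ↥(IntermediateField.adjoin ℚ ({i} : Set (AlgebraicClosure ℚ)) ⊔ ℚ⟮4 * delta W two_ne_zero⟯) (AlgebraicClosure ℚ)) hz
    rw [map_pow, map_ofNat] at h
    apply (algebraMap ↥(W.divisionField 2 ⊔ IntermediateField.adjoin ℚ ({i} : Set (AlgebraicClosure ℚ))) (AlgebraicClosure ℚ)).injective
    rw [map_pow, map_ofNat]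
    exact h
  exact classicalMuVanishes_of_biquadratic hx hy ha hsq hab (finrank_adjoin_I_sup_adjoin_delta W ht hsq hnegΔ hi) h2R κR hκR

/-- ★★ **`μ₂ = 0` on the CM point field `ℚ(β_j, √−1)` ⟹ `μ₂ = 0` on `M = ℚ(W[2], √−1)` AND `λ₂(M) = λ₂(ℚ(i, √Δ_W)) + 2·λ₂(ℚ(β_j, i))` EXACTLY**
(restricted form along the cyclotomic `κ` of `ℚ`; `W(ℚ)[2] = 0`, `Δ_W, −Δ_W, ±2Δ_W ∉ ℚ²`): the folded identity `e_n(M) = e_n(ℚ(i,δ)) + 2e_n(ℚ(β_j,i))` with the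
growth forms of the biquadratic term (`μ₂ = 0`, this file) and of the CM point field (hypothesis). [cite: CaputoNuccio2020, Prop. 3.12]
[cite: Washington1997, §13.3 Thm. 13.13] -/
theorem classicalLambda_sup_adjoin_I_exact (ht : ∀ x : ℚ, ¬ HasRationalTwoTorsionX W x) (hsq : ¬ IsSquare W.Δ)
    (hnegΔ : ¬ IsSquare (-W.Δ)) (h2Δ : ¬ IsSquare (2 * W.Δ)) (hm2Δ : ¬ IsSquare (-2 * W.Δ)) {i : AlgebraicClosure ℚ} (hi : i ^ 2 = -1)
    (j : Fin 3) (κ : ZpExtension ℚ 2) (hκ : κ.IsCyclotomic)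
    [NumberField ↥(W.divisionField 2 ⊔ IntermediateField.adjoin ℚ ({i} : Set (AlgebraicClosure ℚ)))]
    [NumberField ↥(IntermediateField.adjoin ℚ ({i} : Set (AlgebraicClosure ℚ)))]
    [NumberField ↥(IntermediateField.adjoin ℚ ({i} : Set (AlgebraicClosure ℚ)) ⊔ ℚ⟮4 * delta W two_ne_zero⟯)]
    [NumberField ↥(ℚ⟮xT W two_ne_zero j⟯ ⊔ IntermediateField.adjoin ℚ ({i} : Set (AlgebraicClosure ℚ)))]
    (hM : Function.Surjective (κ.toContinuousMonoidHom.comp (absGaloisRestrict ℚ ↥(W.divisionField 2 ⊔ IntermediateField.adjoin ℚ ({i} : Set (AlgebraicClosure ℚ))))))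
    (hQ : Function.Surjective (κ.toContinuousMonoidHom.comp (absGaloisRestrict ℚ ↥(IntermediateField.adjoin ℚ ({i} : Set (AlgebraicClosure ℚ))))))
    (hR : Function.Surjective (κ.toContinuousMonoidHom.comp (absGaloisRestrict ℚ ↥(IntermediateField.adjoin ℚ ({i} : Set (AlgebraicClosure ℚ)) ⊔ ℚ⟮4 * delta W two_ne_zero⟯))))
    (hP : Function.Surjective (κ.toContinuousMonoidHom.comp (absGaloisRestrict ℚ ↥(ℚ⟮xT W two_ne_zero j⟯ ⊔ IntermediateField.adjoin ℚ ({i} : Set (AlgebraicClosure ℚ))))))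
    (hμP : ClassicalMuVanishes (κ.restrict ↥(ℚ⟮xT W two_ne_zero j⟯ ⊔ IntermediateField.adjoin ℚ ({i} : Set (AlgebraicClosure ℚ))) hP)) :
    ClassicalMuVanishes (κ.restrict ↥(W.divisionField 2 ⊔ IntermediateField.adjoin ℚ ({i} : Set (AlgebraicClosure ℚ))) hM) ∧
      classicalLambda (κ.restrict ↥(W.divisionField 2 ⊔ IntermediateField.adjoin ℚ ({i} : Set (AlgebraicClosure ℚ))) hM) =
        classicalLambda (κ.restrict ↥(IntermediateField.adjoin ℚ ({i} : Set (AlgebraicClosure ℚ)) ⊔ ℚ⟮4 * delta W two_ne_zero⟯) hR) + 2 * classicalLambda (κ.restrict ↥(ℚ⟮xT W two_ne_zero j⟯ ⊔ IntermediateField.adjoin ℚ ({i} : Set (AlgebraicClosure ℚ))) hP) := by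
  have hμR : ClassicalMuVanishes (κ.restrict ↥(IntermediateField.adjoin ℚ ({i} : Set (AlgebraicClosure ℚ)) ⊔ ℚ⟮4 * delta W two_ne_zero⟯) hR) :=
    classicalMuVanishes_adjoin_I_sup_adjoin_delta W ht hsq hnegΔ h2Δ hm2Δ hi _ (isCyclotomic_restrict κ hκ _ hR)
  obtain ⟨νR, nR, hgR⟩ := classicalLambda_spec _ hμR
  obtain ⟨νP, nP, hgP⟩ := classicalLambda_spec _ hμP
  set lR := classicalLambda (κ.restrict ↥(IntermediateField.adjoin ℚ ({i} : Set (AlgebraicClosure ℚ)) ⊔ ℚ⟮4 * delta W two_ne_zero⟯) hR) with hlR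
  set lP := classicalLambda (κ.restrict ↥(ℚ⟮xT W two_ne_zero j⟯ ⊔ IntermediateField.adjoin ℚ ({i} : Set (AlgebraicClosure ℚ))) hP) with hlP
  have hid := fun n ↦ classNumberPExp_sup_adjoin_I_eq W ht hsq hnegΔ hi j κ hM hQ hR hP n
  set N := max nR nP with hN
  have hg : ∀ n, N ≤ n → (classNumberPExp (κ.restrict ↥(W.divisionField 2 ⊔ IntermediateField.adjoin ℚ ({i} : Set (AlgebraicClosure ℚ))) hM) n : ℤ) = ((lR + 2 * lP : ℕ) : ℤ) * n + (νR + 2 * νP) := by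
    intro n hn
    have h1 := hgR n (le_trans (le_max_left _ _) hn)
    have h2 := hgP n (le_trans (le_max_right _ _) hn)
    have h3 : (classNumberPExp (κ.restrict ↥(W.divisionField 2 ⊔ IntermediateField.adjoin ℚ ({i} : Set (AlgebraicClosure ℚ))) hM) n : ℤ) =
        classNumberPExp (κ.restrict ↥(IntermediateField.adjoin ℚ ({i} : Set (AlgebraicClosure ℚ)) ⊔ ℚ⟮4 * delta W two_ne_zero⟯) hR) n + 2 * classNumberPExp (κ.restrict ↥(ℚ⟮xT W two_ne_zero j⟯ ⊔ IntermediateField.adjoin ℚ ({i} : Set (AlgebraicClosure ℚ))) hP) n := by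
      exact_mod_cast hid n
    rw [h3, h1, h2]
    push_cast
    ring
  exact ⟨⟨lR + 2 * lP, νR + 2 * νP, N, hg⟩, (eq_classicalLambda_of_growth _ hg).symm⟩

/-- ★★ **On C2's binders, intrinsic form.**  `W` globally minimal, good ordinary at `2` (so `±2Δ_W ∉ ℚ²`), no rational `2`-torsion abscissa, `Δ_W ∉ ℚ²`,
`−Δ_W ∉ ℚ²`, `i² = −1`; `κM, κR, κP` ANY cyclotomic `ℤ₂`-extensions of `M = ℚ(W[2], i)`, `ℚ(i, δ)`, `ℚ(β_j, i)`.  If `μ₂ = 0` for the cyclotomic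
`ℤ₂`-extensions of the CM point field `ℚ(β_j, i)` (the PFμ⁺ price of att-p3 g34), then **`μ₂(M) = 0` and `λ(κM) = λ(κR) + 2·λ(κP)`**.  The biquadratic
`λ(κR) = λ₂(ℚ(i,√Δ_W))` is a genus-theory quantity; nothing about its value is claimed. [cite: CaputoNuccio2020, Prop. 3.12] [cite: Washington1997, §13.3] -/
theorem classicalLambda_sup_adjoin_I_eq_of_isOrdinaryAt [W.IsGloballyMinimal] (hord : IsOrdinaryAt W 2)
    (ht : ∀ x : ℚ, ¬ HasRationalTwoTorsionX W x) (hsq : ¬ IsSquare W.Δ) (hnegΔ : ¬ IsSquare (-W.Δ)) {i : AlgebraicClosure ℚ} (hi : i ^ 2 = -1)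
    (j : Fin 3)
    [NumberField ↥(W.divisionField 2 ⊔ IntermediateField.adjoin ℚ ({i} : Set (AlgebraicClosure ℚ)))]
    [NumberField ↥(IntermediateField.adjoin ℚ ({i} : Set (AlgebraicClosure ℚ)) ⊔ ℚ⟮4 * delta W two_ne_zero⟯)]
    [NumberField ↥(ℚ⟮xT W two_ne_zero j⟯ ⊔ IntermediateField.adjoin ℚ ({i} : Set (AlgebraicClosure ℚ)))]
    (hμP : ∀ κP : ZpExtension ↥(ℚ⟮xT W two_ne_zero j⟯ ⊔ IntermediateField.adjoin ℚ ({i} : Set (AlgebraicClosure ℚ))) 2, κP.IsCyclotomic → ClassicalMuVanishes κP)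
    (κM : ZpExtension ↥(W.divisionField 2 ⊔ IntermediateField.adjoin ℚ ({i} : Set (AlgebraicClosure ℚ))) 2) (hκM : κM.IsCyclotomic)
    (κR : ZpExtension ↥(IntermediateField.adjoin ℚ ({i} : Set (AlgebraicClosure ℚ)) ⊔ ℚ⟮4 * delta W two_ne_zero⟯) 2) (hκR : κR.IsCyclotomic)
    (κP : ZpExtension ↥(ℚ⟮xT W two_ne_zero j⟯ ⊔ IntermediateField.adjoin ℚ ({i} : Set (AlgebraicClosure ℚ))) 2) (hκP : κP.IsCyclotomic) :
    ClassicalMuVanishes κM ∧ classicalLambda κM = classicalLambda κR + 2 * classicalLambda κP := by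
  haveI : Fact (Nat.Prime 2) := ⟨Nat.prime_two⟩
  have h2Δ := not_isSquare_two_mul_Δ_of_isOrdinaryAt W hord
  have hm2Δ := not_isSquare_neg_two_mul_Δ_of_isOrdinaryAt W hord
  have hint : IsIntegral ℚ i := by
    refine ⟨X ^ 2 + 1, monic_X_pow_add_C _ two_ne_zero, ?_⟩
    simp [hi]
  haveI : FiniteDimensional ℚ ↥(IntermediateField.adjoin ℚ ({i} : Set (AlgebraicClosure ℚ))) := IntermediateField.adjoin.finiteDimensional hint
  haveI : NumberField ↥(IntermediateField.adjoin ℚ ({i} : Set (AlgebraicClosure ℚ))) := NumberField.mk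
  obtain ⟨κ, hκ⟩ := exists_cyclotomicZpExtension_holds ℚ 2
  have hM := surjective_gal_restrict_sup_adjoin_I W ht hsq h2Δ hm2Δ hi κ hκ
  -- the three subfields as subalgebras of `M`
  letI aQ : Algebra ↥(IntermediateField.adjoin ℚ ({i} : Set (AlgebraicClosure ℚ))) ↥(W.divisionField 2 ⊔ IntermediateField.adjoin ℚ ({i} : Set (AlgebraicClosure ℚ))) := (IntermediateField.inclusion (adjoin_I_le_sup W i)).toRingHom.toAlgebra
  haveI : IsScalarTower ℚ ↥(IntermediateField.adjoin ℚ ({i} : Set (AlgebraicClosure ℚ))) ↥(W.divisionField 2 ⊔ IntermediateField.adjoin ℚ ({i} : Set (AlgebraicClosure ℚ))) := IsScalarTower.of_algebraMap_eq fun _ ↦ rfl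
  letI aR : Algebra ↥(IntermediateField.adjoin ℚ ({i} : Set (AlgebraicClosure ℚ)) ⊔ ℚ⟮4 * delta W two_ne_zero⟯) ↥(W.divisionField 2 ⊔ IntermediateField.adjoin ℚ ({i} : Set (AlgebraicClosure ℚ))) := (IntermediateField.inclusion (adjoin_I_sup_adjoin_delta_le_sup W i)).toRingHom.toAlgebra
  haveI : IsScalarTower ℚ ↥(IntermediateField.adjoin ℚ ({i} : Set (AlgebraicClosure ℚ)) ⊔ ℚ⟮4 * delta W two_ne_zero⟯) ↥(W.divisionField 2 ⊔ IntermediateField.adjoin ℚ ({i} : Set (AlgebraicClosure ℚ))) := IsScalarTower.of_algebraMap_eq fun _ ↦ rfl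
  letI aP : Algebra ↥(ℚ⟮xT W two_ne_zero j⟯ ⊔ IntermediateField.adjoin ℚ ({i} : Set (AlgebraicClosure ℚ))) ↥(W.divisionField 2 ⊔ IntermediateField.adjoin ℚ ({i} : Set (AlgebraicClosure ℚ))) := (IntermediateField.inclusion (adjoin_xT_sup_adjoin_I_le_sup W i j)).toRingHom.toAlgebra
  haveI : IsScalarTower ℚ ↥(ℚ⟮xT W two_ne_zero j⟯ ⊔ IntermediateField.adjoin ℚ ({i} : Set (AlgebraicClosure ℚ))) ↥(W.divisionField 2 ⊔ IntermediateField.adjoin ℚ ({i} : Set (AlgebraicClosure ℚ))) := IsScalarTower.of_algebraMap_eq fun _ ↦ rfl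
  have hQ := surjective_comp_absGaloisRestrict_of_tower κ ↥(IntermediateField.adjoin ℚ ({i} : Set (AlgebraicClosure ℚ))) ↥(W.divisionField 2 ⊔ IntermediateField.adjoin ℚ ({i} : Set (AlgebraicClosure ℚ))) hM
  have hR := surjective_comp_absGaloisRestrict_of_tower κ ↥(IntermediateField.adjoin ℚ ({i} : Set (AlgebraicClosure ℚ)) ⊔ ℚ⟮4 * delta W two_ne_zero⟯) ↥(W.divisionField 2 ⊔ IntermediateField.adjoin ℚ ({i} : Set (AlgebraicClosure ℚ))) hM
  have hP := surjective_comp_absGaloisRestrict_of_tower κ ↥(ℚ⟮xT W two_ne_zero j⟯ ⊔ IntermediateField.adjoin ℚ ({i} : Set (AlgebraicClosure ℚ))) ↥(W.divisionField 2 ⊔ IntermediateField.adjoin ℚ ({i} : Set (AlgebraicClosure ℚ))) hM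
  have main := classicalLambda_sup_adjoin_I_exact W ht hsq hnegΔ h2Δ hm2Δ hi j κ hκ hM hQ hR hP
    (hμP _ (isCyclotomic_restrict κ hκ _ hP))
  refine ⟨(classicalMuVanishes_iff_of_isCyclotomic _ _ (isCyclotomic_restrict κ hκ _ hM) hκM).mp main.1, ?_⟩
  rw [classicalLambda_eq_of_isCyclotomic κM _ hκM (isCyclotomic_restrict κ hκ _ hM),
    classicalLambda_eq_of_isCyclotomic κR _ hκR (isCyclotomic_restrict κ hκ _ hR),
    classicalLambda_eq_of_isCyclotomic κP _ hκP (isCyclotomic_restrict κ hκ _ hP)]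
  exact main.2


/-! ## §6 The exact identity on C2's binders, for ANY cyclotomic towers (appended, same seat) -/

/-- ★★ **`e_n(ℚ(W[2], i)) = e_n(ℚ(i, √Δ_W)) + 2·e_n(ℚ(β_j, i))` for every `n` and ANY cyclotomic `ℤ₂`-extensions `κM, κR, κP` of the three fields**
(`W` globally minimal, good ordinary at `2` — so `±2Δ_W ∉ ℚ²` —, `W(ℚ)[2] = 0`, `Δ_W, −Δ_W ∉ ℚ²`, `i² = −1`): the restricted identity of §4 along the
cyclotomic tower of `ℚ`, transported by «all cyclotomic towers of a field share their `e_n`» (`classNumberPExp_eq_of_isCyclotomic`).  The consumer /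
-data form: a zero-cost check on class-number tables at every layer. [cite: CaputoNuccio2020, Prop. 3.12] [cite: Washington1997, §13.1, Prop. 13.22] -/
theorem classNumberPExp_sup_adjoin_I_eq_of_isOrdinaryAt [W.IsGloballyMinimal] (hord : IsOrdinaryAt W 2)
    (ht : ∀ x : ℚ, ¬ HasRationalTwoTorsionX W x) (hsq : ¬ IsSquare W.Δ) (hnegΔ : ¬ IsSquare (-W.Δ)) {i : AlgebraicClosure ℚ} (hi : i ^ 2 = -1)
    (j : Fin 3)
    [NumberField ↥(W.divisionField 2 ⊔ IntermediateField.adjoin ℚ ({i} : Set (AlgebraicClosure ℚ)))] [NumberField ↥(IntermediateField.adjoin ℚ ({i} : Set (AlgebraicClosure ℚ)) ⊔ ℚ⟮4 * delta W two_ne_zero⟯)] [NumberField ↥(ℚ⟮xT W two_ne_zero j⟯ ⊔ IntermediateField.adjoin ℚ ({i} : Set (AlgebraicClosure ℚ)))]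
    (κM : ZpExtension ↥(W.divisionField 2 ⊔ IntermediateField.adjoin ℚ ({i} : Set (AlgebraicClosure ℚ))) 2) (hκM : κM.IsCyclotomic)
    (κR : ZpExtension ↥(IntermediateField.adjoin ℚ ({i} : Set (AlgebraicClosure ℚ)) ⊔ ℚ⟮4 * delta W two_ne_zero⟯) 2) (hκR : κR.IsCyclotomic)
    (κP : ZpExtension ↥(ℚ⟮xT W two_ne_zero j⟯ ⊔ IntermediateField.adjoin ℚ ({i} : Set (AlgebraicClosure ℚ))) 2) (hκP : κP.IsCyclotomic) (n : ℕ) :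
    classNumberPExp κM n = classNumberPExp κR n + 2 * classNumberPExp κP n := by
  haveI : Fact (Nat.Prime 2) := ⟨Nat.prime_two⟩
  have h2Δ := not_isSquare_two_mul_Δ_of_isOrdinaryAt W hord
  have hm2Δ := not_isSquare_neg_two_mul_Δ_of_isOrdinaryAt W hord
  have hint : IsIntegral ℚ i := by
    refine ⟨X ^ 2 + 1, monic_X_pow_add_C _ two_ne_zero, ?_⟩
    simp [hi]
  haveI : FiniteDimensional ℚ ↥(IntermediateField.adjoin ℚ ({i} : Set (AlgebraicClosure ℚ))) := IntermediateField.adjoin.finiteDimensional hint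
  haveI : NumberField ↥(IntermediateField.adjoin ℚ ({i} : Set (AlgebraicClosure ℚ))) := NumberField.mk
  obtain ⟨κ, hκ⟩ := exists_cyclotomicZpExtension_holds ℚ 2
  have hM := surjective_gal_restrict_sup_adjoin_I W ht hsq h2Δ hm2Δ hi κ hκ
  letI aQ : Algebra ↥(IntermediateField.adjoin ℚ ({i} : Set (AlgebraicClosure ℚ))) ↥(W.divisionField 2 ⊔ IntermediateField.adjoin ℚ ({i} : Set (AlgebraicClosure ℚ))) := (IntermediateField.inclusion (adjoin_I_le_sup W i)).toRingHom.toAlgebra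
  haveI : IsScalarTower ℚ ↥(IntermediateField.adjoin ℚ ({i} : Set (AlgebraicClosure ℚ))) ↥(W.divisionField 2 ⊔ IntermediateField.adjoin ℚ ({i} : Set (AlgebraicClosure ℚ))) := IsScalarTower.of_algebraMap_eq fun _ ↦ rfl
  letI aR : Algebra ↥(IntermediateField.adjoin ℚ ({i} : Set (AlgebraicClosure ℚ)) ⊔ ℚ⟮4 * delta W two_ne_zero⟯) ↥(W.divisionField 2 ⊔ IntermediateField.adjoin ℚ ({i} : Set (AlgebraicClosure ℚ))) := (IntermediateField.inclusion (adjoin_I_sup_adjoin_delta_le_sup W i)).toRingHom.toAlgebra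
  haveI : IsScalarTower ℚ ↥(IntermediateField.adjoin ℚ ({i} : Set (AlgebraicClosure ℚ)) ⊔ ℚ⟮4 * delta W two_ne_zero⟯) ↥(W.divisionField 2 ⊔ IntermediateField.adjoin ℚ ({i} : Set (AlgebraicClosure ℚ))) := IsScalarTower.of_algebraMap_eq fun _ ↦ rfl
  letI aP : Algebra ↥(ℚ⟮xT W two_ne_zero j⟯ ⊔ IntermediateField.adjoin ℚ ({i} : Set (AlgebraicClosure ℚ))) ↥(W.divisionField 2 ⊔ IntermediateField.adjoin ℚ ({i} : Set (AlgebraicClosure ℚ))) := (IntermediateField.inclusion (adjoin_xT_sup_adjoin_I_le_sup W i j)).toRingHom.toAlgebra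
  haveI : IsScalarTower ℚ ↥(ℚ⟮xT W two_ne_zero j⟯ ⊔ IntermediateField.adjoin ℚ ({i} : Set (AlgebraicClosure ℚ))) ↥(W.divisionField 2 ⊔ IntermediateField.adjoin ℚ ({i} : Set (AlgebraicClosure ℚ))) := IsScalarTower.of_algebraMap_eq fun _ ↦ rfl
  have hQ := surjective_comp_absGaloisRestrict_of_tower κ ↥(IntermediateField.adjoin ℚ ({i} : Set (AlgebraicClosure ℚ))) ↥(W.divisionField 2 ⊔ IntermediateField.adjoin ℚ ({i} : Set (AlgebraicClosure ℚ))) hM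
  have hR := surjective_comp_absGaloisRestrict_of_tower κ ↥(IntermediateField.adjoin ℚ ({i} : Set (AlgebraicClosure ℚ)) ⊔ ℚ⟮4 * delta W two_ne_zero⟯) ↥(W.divisionField 2 ⊔ IntermediateField.adjoin ℚ ({i} : Set (AlgebraicClosure ℚ))) hM
  have hP := surjective_comp_absGaloisRestrict_of_tower κ ↥(ℚ⟮xT W two_ne_zero j⟯ ⊔ IntermediateField.adjoin ℚ ({i} : Set (AlgebraicClosure ℚ))) ↥(W.divisionField 2 ⊔ IntermediateField.adjoin ℚ ({i} : Set (AlgebraicClosure ℚ))) hM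
  have main := classNumberPExp_sup_adjoin_I_eq W ht hsq hnegΔ hi j κ hM hQ hR hP n
  rw [classNumberPExp_eq_of_isCyclotomic κM _ hκM (isCyclotomic_restrict κ hκ _ hM) n,
    classNumberPExp_eq_of_isCyclotomic κR _ hκR (isCyclotomic_restrict κ hκ _ hR) n,
    classNumberPExp_eq_of_isCyclotomic κP _ hκP (isCyclotomic_restrict κ hκ _ hP) n]
  exact main

end Summit.BirchSwinnertonDyer.BirchSwinnertonDyer.Theorems.AlignedTransportAtTwoPointFieldCarrierDSixExact

end
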